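import Summits.QuantumFields.BalabanUV.Beta.GAN24.CapacitanceCancellationDefect

/-!
# `BalabanUV.Beta.GAN24.ArrowAnchorRealBorders` — binder row G-an2-4 / (CONV-C), road P1-fibre, p1 row **P1-L10** `FibreStrip` ((I3′)), leaf-16's cut (M4)
# `L10-CUT-M4.md` row **F5 `ArrowAnchorReal`** (OUTER ANCHOR), PREP PART (ii): THE FOUR OUTER-SCALED BORDER FROBENIUS SUMS ARE O(1)

NOT IN PRINT; OUR PROOF ATTEMPT.  HONEST FRAMING (cell contract, verbatim): «discharging `BetaPertH` makes Bałaban's UV stability UNCONDITIONAL — a real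
constructive-QFT result; it is NOT the continuum limit and NOT the Clay problem.»  HONEST DEPENDENCY (verbatim): «continuum YM on T⁴ ⇐ BetaPertH ∧ nine spine
estimates (0/9 proved); BetaPertH ⇐ (D1) ∧ (D4) ∧ CAP+tail; G-an2-4 gates asym, D1 and NE2/3/4.»  [folklore] explicit finite alias sums in the REAL currency of
leaf-12's `CapacitanceScalarBounds` (`blockWt = |S(m)|²/N^D`, `gNormSq = |s_κ(m)|²`, L06 `kfine`, `lapR`, `wMaj`) with the landed inputs BY NAME: `blockWt_le_pow`,
`gNormSq_le_sq`, `sq_mul_lapR_zero_le`, `lapR_zero_pos` (leaf-12), `AliasWeightsSum.four_le_sq_mul_lapR` / `sum_prod_wMaj_le` (L06, leaf-17),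
`CapacitanceCancellation.blockWt_le_momSq_of_ne_zero` (Y08cc, leaf-09: a NONZERO-alias weight carries `|q|²/4`), `CapacitanceCancellationDefect.momSq_le_of_abs_le`;
no cited fact, no wall binder, no `def`, no `def … : Prop`.  NOT summit progress: nothing of (CONV-C)'s K-slot `GAN24.CombesThomas.ConvCK 3 Lc` is discharged here
(F5 is one of the four anchor/Lipschitz inputs of F7 = (U1) on the road to EXACTLY (I3′)); 0 wall binders; NOT `BetaPertH`, NOT continuum, NOT Clay.

## What is proved (every `D`, every `N ≥ 1`, every `q ∈ [−π, π]^D` with `q ≠ 0`)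
OUTER SCALING of `L10-CUT-M4.md` §1 / F1c `ArrowScaling` (leaf-16-g6, CLAIMS l.3224 (C)): radii `r_m² := N²·lapR (kfine N q m)` (ALL m; `r_0² = N²L₀ ≍ |q|²`),
global scalings `φ × r_0²/N³`, `c × r_0³/N³`, `Q × N^{−(D+1)}`, `M × r_0/N^{D+1}`, local scalings `EL × N²/r_m²`, `G × N³/r_m³`, `μ × N/r_m`.  At the real anchor the
squared moduli of the four scaled border weights are (using `|χ̂_m|² = blockWt/N^D`, `|s♭_κ(m)|² = |s_κ(m)|² = gNormSq`):
  `|wẼ(m,κ)|² = blockWt·gNormSq_κ·r_0⁴/(N^{D+2}·r_m⁴)`, `|wG̃(m)|² = (blockWt/N^D)·r_0⁶/r_m⁶`, `|wQ̃(m,κ)|² = blockWt·gNormSq_κ/N^{D+2}`, `|wM̃(m)|² = (blockWt/N^D)·r_0²/r_m²`.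
THIS FILE bounds the four alias sums of these real expressions, q- AND N-UNIFORMLY (m = 0 summands ≤ 1 exactly by normalisation; m ≠ 0 summands carry
`(|q|²/4)·Π_i wMaj` and `r_m² ≥ 4`, `r_0² ≤ |q|² ≤ Dπ²`, `Σ_{m≠0} Π wMaj ≤ 5^D − 1`):
* **`sum_wE_sq_le`**: `Σ_m Σ_κ blockWt·gNormSq_κ·(N²L₀)²/(N^{D+2}·(N²L_m)²) ≤ D·(1 + (Dπ²)³(5^D − 1)/64)`;
* **`sum_wG_sq_le`**: `Σ_m (blockWt/N^D)·(N²L₀)³/(N²L_m)³ ≤ 1 + (Dπ²)⁴(5^D − 1)/256`;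
* **`sum_wQ_sq_le`**: `Σ_m Σ_κ blockWt·gNormSq_κ/N^{D+2} ≤ D·(1 + Dπ²(5^D − 1)/4)`;
* **`sum_wM_sq_le`**: `Σ_m (blockWt/N^D)·(N²L₀)/(N²L_m) ≤ 1 + (Dπ²)²(5^D − 1)/16`.
Consumer: F5 proper (`ArrowAnchorReal`, this seat): `u := √(wE-sum + wG-sum)`, `v := √(wQ-sum + wM-sum)` via F1b `ArrowNorms.norm_colBorder_le` /
`norm_rowBorder_le` once F1c's `outerArrow` weights are in the tree (their squared moduli at real q ARE these summands).
Unit `b2b-balaban-gan24-formalise-leaf-12` (G-an2-4 formalisation swarm, leaf prover 12, gen 7), 2026-08-20.  Value = kernel bookkeeping toward (I3′), NOT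
summit progress.
-/

noncomputable section

open Complex Finset
open scoped BigOperators Real

namespace Summit.QuantumFields.BalabanUV.Beta.GAN24.ArrowAnchorRealBorders

open Literature.MathematicalPhysics.QuantumFieldTheory.King1986 (momSq momSq_nonneg)
open AliasWeights AliasWeightsSum CapacitanceScalarBounds
open CapacitanceCancellation (blockWt_le_momSq_of_ne_zero)
open CapacitanceCancellationDefect (momSq_le_of_abs_le)

variable {D : ℕ} {N : ℕ} {q : Fin D → ℝ}

/-! ## §1 Elementary facts about the radii `r_m² = N²·L_m` at the real anchor -/

/-- [folklore] `0 < N²L₀` for `q ≠ 0`. -/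
theorem R0_pos (hN : 1 ≤ N) (hq : ∀ i, |q i| ≤ π) (hq0 : q ≠ 0) : 0 < (N : ℝ) ^ 2 * lapR (kfine N q 0) := by
  have hN0 : (0 : ℝ) < N := by exact_mod_cast hN
  exact mul_pos (by positivity) (lapR_zero_pos hN hq hq0)

/-- [folklore] `N²L₀ ≤ |q|² ≤ D·π²` on the zone. -/
theorem R0_le (hN : 1 ≤ N) (hq : ∀ i, |q i| ≤ π) : (N : ℝ) ^ 2 * lapR (kfine N q 0) ≤ D * π ^ 2 :=
  (sq_mul_lapR_zero_le hN q).trans (momSq_le_of_abs_le hq)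

/-- [folklore] `4 ≤ N²L_m` off the zero alias (hence `0 < N²L_m`). -/
theorem Rm_pos [NeZero N] (hq : ∀ i, |q i| ≤ π) {m : Fin D → ZMod N} (hm : m ≠ 0) : 0 < (N : ℝ) ^ 2 * lapR (kfine N q m) :=
  lt_of_lt_of_le (by norm_num) (four_le_sq_mul_lapR hq hm)

/-- [folklore] `Σ_{m ≠ 0} Π_i wMaj N (m i) ≤ 5^D − 1` (L06 by name) and `0 ≤ 5^D − 1`. -/
theorem five_pow_sub_one_nonneg (D : ℕ) : (0 : ℝ) ≤ (5 : ℝ) ^ D - 1 := by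
  have : (1 : ℝ) ≤ (5 : ℝ) ^ D := one_le_pow₀ (by norm_num)
  linarith

/-- [folklore] The `m ≠ 0` weight in the form used below: `blockWt/N^D ≤ (|q|²/4)·Π wMaj ≤ (Dπ²/4)·Π wMaj`. -/
theorem blockWt_div_le_of_ne_zero [NeZero N] (hN : 1 ≤ N) (hq : ∀ i, |q i| ≤ π) {m : Fin D → ZMod N} (hm : m ≠ 0) :
    blockWt N q m / (N : ℝ) ^ D ≤ momSq q / 4 * ∏ i, wMaj N (m i) := by
  have hN0 : (0 : ℝ) < N := by exact_mod_cast hN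
  rw [div_le_iff₀ (by positivity)]
  calc blockWt N q m ≤ momSq q / 4 * ((N : ℝ) ^ D * ∏ i, wMaj N (m i)) := blockWt_le_momSq_of_ne_zero hq hm
    _ = momSq q / 4 * (∏ i, wMaj N (m i)) * (N : ℝ) ^ D := by ring

/-! ## §2 Per-alias bounds of the four squared scaled weights -/

/-- [folklore] ZERO ALIAS, `wẼ`: `blockWt₀·gNormSq_κ(0)·(N²L₀)²/(N^{D+2}(N²L₀)²) ≤ 1`. -/
theorem wE_sq_zero_le (hN : 1 ≤ N) (hq : ∀ i, |q i| ≤ π) (hq0 : q ≠ 0) (κ : Fin D) :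
    blockWt N q 0 * gNormSq N (kfine N q 0 κ) * ((N : ℝ) ^ 2 * lapR (kfine N q 0)) ^ 2 /
        ((N : ℝ) ^ (D + 2) * ((N : ℝ) ^ 2 * lapR (kfine N q 0)) ^ 2) ≤ 1 := by
  have hN0 : (0 : ℝ) < N := by exact_mod_cast hN
  have hR := R0_pos hN hq hq0
  rw [div_le_one (by positivity), pow_add]
  have h1 := blockWt_le_pow hN q (0 : Fin D → ZMod N)
  have h2 := gNormSq_le_sq N (kfine N q 0 κ)
  have := mul_le_mul h1 h2 (gNormSq_nonneg _ _) (by positivity)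
  nlinarith [blockWt_nonneg N q 0, gNormSq_nonneg N (kfine N q 0 κ), hR.le]

/-- [folklore] NONZERO ALIAS, `wẼ`: `… ≤ (Dπ²)³/64 · Π wMaj`. -/
theorem wE_sq_ne_zero_le [NeZero N] (hN : 1 ≤ N) (hq : ∀ i, |q i| ≤ π) (hq0 : q ≠ 0) {m : Fin D → ZMod N} (hm : m ≠ 0) (κ : Fin D) :
    blockWt N q m * gNormSq N (kfine N q m κ) * ((N : ℝ) ^ 2 * lapR (kfine N q 0)) ^ 2 /
        ((N : ℝ) ^ (D + 2) * ((N : ℝ) ^ 2 * lapR (kfine N q m)) ^ 2)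
      ≤ ((D : ℝ) * π ^ 2) ^ 3 / 64 * ∏ i, wMaj N (m i) := by
  have hN0 : (0 : ℝ) < N := by exact_mod_cast hN
  have hRm := four_le_sq_mul_lapR hq hm
  have hRmpos := Rm_pos hq hm
  have hR0 := R0_le hN hq
  have hR0nn : 0 ≤ (N : ℝ) ^ 2 * lapR (kfine N q 0) := (R0_pos hN hq hq0).le
  have hW : 0 ≤ ∏ i, wMaj N (m i) := Finset.prod_nonneg fun i _ => wMaj_nonneg _ _
  have hw := blockWt_div_le_of_ne_zero hN hq hm
  have hmq := momSq_le_of_abs_le hq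
  have hg := gNormSq_le_sq N (kfine N q m κ)
  -- rewrite the summand as (blockWt/N^D)·(gNormSq/N²)·(R0²/Rm²)
  have e : blockWt N q m * gNormSq N (kfine N q m κ) * ((N : ℝ) ^ 2 * lapR (kfine N q 0)) ^ 2 /
        ((N : ℝ) ^ (D + 2) * ((N : ℝ) ^ 2 * lapR (kfine N q m)) ^ 2)
      = (blockWt N q m / (N : ℝ) ^ D) * (gNormSq N (kfine N q m κ) / (N : ℝ) ^ 2) *
          (((N : ℝ) ^ 2 * lapR (kfine N q 0)) ^ 2 / ((N : ℝ) ^ 2 * lapR (kfine N q m)) ^ 2) := by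
    rw [pow_add]; field_simp
  rw [e]
  have h1 : blockWt N q m / (N : ℝ) ^ D ≤ (D * π ^ 2) / 4 * ∏ i, wMaj N (m i) :=
    hw.trans (mul_le_mul_of_nonneg_right (by linarith) hW)
  have h2 : gNormSq N (kfine N q m κ) / (N : ℝ) ^ 2 ≤ 1 := by rw [div_le_one (by positivity)]; exact hg
  have h3 : ((N : ℝ) ^ 2 * lapR (kfine N q 0)) ^ 2 / ((N : ℝ) ^ 2 * lapR (kfine N q m)) ^ 2 ≤ (D * π ^ 2) ^ 2 / 16 := by
    rw [div_le_div_iff₀ (by positivity) (by norm_num)]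
    have hnum : ((N : ℝ) ^ 2 * lapR (kfine N q 0)) ^ 2 ≤ (D * π ^ 2) ^ 2 := pow_le_pow_left₀ hR0nn hR0 2
    have hden : (16 : ℝ) ≤ ((N : ℝ) ^ 2 * lapR (kfine N q m)) ^ 2 := by nlinarith
    calc ((N : ℝ) ^ 2 * lapR (kfine N q 0)) ^ 2 * 16 ≤ (D * π ^ 2) ^ 2 * 16 := by nlinarith
      _ ≤ (D * π ^ 2) ^ 2 * ((N : ℝ) ^ 2 * lapR (kfine N q m)) ^ 2 := by nlinarith [sq_nonneg ((D : ℝ) * π ^ 2)]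
  have hb0 : 0 ≤ blockWt N q m / (N : ℝ) ^ D := div_nonneg (blockWt_nonneg _ _ _) (by positivity)
  have hg0 : 0 ≤ gNormSq N (kfine N q m κ) / (N : ℝ) ^ 2 := div_nonneg (gNormSq_nonneg _ _) (by positivity)
  calc (blockWt N q m / (N : ℝ) ^ D) * (gNormSq N (kfine N q m κ) / (N : ℝ) ^ 2) *
          (((N : ℝ) ^ 2 * lapR (kfine N q 0)) ^ 2 / ((N : ℝ) ^ 2 * lapR (kfine N q m)) ^ 2)
      ≤ ((D * π ^ 2) / 4 * ∏ i, wMaj N (m i)) * 1 * ((D * π ^ 2) ^ 2 / 16) :=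
        mul_le_mul (mul_le_mul h1 h2 hg0 (by positivity)) h3 (by positivity) (by positivity)
    _ = ((D : ℝ) * π ^ 2) ^ 3 / 64 * ∏ i, wMaj N (m i) := by ring

/-- [folklore] ZERO ALIAS, `wG̃`: `(blockWt₀/N^D)·(N²L₀)³/(N²L₀)³ ≤ 1`. -/
theorem wG_sq_zero_le (hN : 1 ≤ N) (hq : ∀ i, |q i| ≤ π) (hq0 : q ≠ 0) :
    blockWt N q 0 / (N : ℝ) ^ D * (((N : ℝ) ^ 2 * lapR (kfine N q 0)) ^ 3 / ((N : ℝ) ^ 2 * lapR (kfine N q 0)) ^ 3) ≤ 1 := by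
  have hN0 : (0 : ℝ) < N := by exact_mod_cast hN
  have hR := R0_pos hN hq hq0
  rw [div_self (pow_ne_zero _ hR.ne'), mul_one, div_le_one (by positivity)]
  exact blockWt_le_pow hN q 0

/-- [folklore] NONZERO ALIAS, `wG̃`: `(blockWt/N^D)·(N²L₀)³/(N²L_m)³ ≤ (Dπ²)⁴/256 · Π wMaj`. -/
theorem wG_sq_ne_zero_le [NeZero N] (hN : 1 ≤ N) (hq : ∀ i, |q i| ≤ π) (hq0 : q ≠ 0) {m : Fin D → ZMod N} (hm : m ≠ 0) :
    blockWt N q m / (N : ℝ) ^ D * (((N : ℝ) ^ 2 * lapR (kfine N q 0)) ^ 3 / ((N : ℝ) ^ 2 * lapR (kfine N q m)) ^ 3)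
      ≤ ((D : ℝ) * π ^ 2) ^ 4 / 256 * ∏ i, wMaj N (m i) := by
  have hN0 : (0 : ℝ) < N := by exact_mod_cast hN
  have hRm := four_le_sq_mul_lapR hq hm
  have hRmpos := Rm_pos hq hm
  have hR0 := R0_le hN hq
  have hR0nn : 0 ≤ (N : ℝ) ^ 2 * lapR (kfine N q 0) := (R0_pos hN hq hq0).le
  have hW : 0 ≤ ∏ i, wMaj N (m i) := Finset.prod_nonneg fun i _ => wMaj_nonneg _ _
  have hmq := momSq_le_of_abs_le hq
  have h1 : blockWt N q m / (N : ℝ) ^ D ≤ (D * π ^ 2) / 4 * ∏ i, wMaj N (m i) :=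
    (blockWt_div_le_of_ne_zero hN hq hm).trans (mul_le_mul_of_nonneg_right (by linarith) hW)
  have h3 : ((N : ℝ) ^ 2 * lapR (kfine N q 0)) ^ 3 / ((N : ℝ) ^ 2 * lapR (kfine N q m)) ^ 3 ≤ (D * π ^ 2) ^ 3 / 64 := by
    rw [div_le_div_iff₀ (by positivity) (by norm_num)]
    have hnum : ((N : ℝ) ^ 2 * lapR (kfine N q 0)) ^ 3 ≤ (D * π ^ 2) ^ 3 := pow_le_pow_left₀ hR0nn hR0 3
    have hden : (64 : ℝ) ≤ ((N : ℝ) ^ 2 * lapR (kfine N q m)) ^ 3 := by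
      calc (64 : ℝ) = 4 ^ 3 := by norm_num
        _ ≤ ((N : ℝ) ^ 2 * lapR (kfine N q m)) ^ 3 := pow_le_pow_left₀ (by norm_num) hRm 3
    have h0 : (0 : ℝ) ≤ (D * π ^ 2) ^ 3 := by positivity
    calc ((N : ℝ) ^ 2 * lapR (kfine N q 0)) ^ 3 * 64 ≤ (D * π ^ 2) ^ 3 * 64 := by nlinarith
      _ ≤ (D * π ^ 2) ^ 3 * ((N : ℝ) ^ 2 * lapR (kfine N q m)) ^ 3 := mul_le_mul_of_nonneg_left hden h0
  have hb0 : 0 ≤ blockWt N q m / (N : ℝ) ^ D := div_nonneg (blockWt_nonneg _ _ _) (by positivity)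
  calc blockWt N q m / (N : ℝ) ^ D * (((N : ℝ) ^ 2 * lapR (kfine N q 0)) ^ 3 / ((N : ℝ) ^ 2 * lapR (kfine N q m)) ^ 3)
      ≤ ((D * π ^ 2) / 4 * ∏ i, wMaj N (m i)) * ((D * π ^ 2) ^ 3 / 64) := mul_le_mul h1 h3 (by positivity) (by positivity)
    _ = ((D : ℝ) * π ^ 2) ^ 4 / 256 * ∏ i, wMaj N (m i) := by ring

/-- [folklore] ZERO ALIAS, `wQ̃`: `blockWt₀·gNormSq_κ(0)/N^{D+2} ≤ 1`. -/
theorem wQ_sq_zero_le (hN : 1 ≤ N) (κ : Fin D) :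
    blockWt N q 0 * gNormSq N (kfine N q 0 κ) / (N : ℝ) ^ (D + 2) ≤ 1 := by
  have hN0 : (0 : ℝ) < N := by exact_mod_cast hN
  rw [div_le_one (by positivity), pow_add]
  exact mul_le_mul (blockWt_le_pow hN q 0) (gNormSq_le_sq N _) (gNormSq_nonneg _ _) (by positivity)

/-- [folklore] NONZERO ALIAS, `wQ̃`: `blockWt·gNormSq_κ/N^{D+2} ≤ (Dπ²/4)·Π wMaj`. -/
theorem wQ_sq_ne_zero_le [NeZero N] (hN : 1 ≤ N) (hq : ∀ i, |q i| ≤ π) {m : Fin D → ZMod N} (hm : m ≠ 0) (κ : Fin D) :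
    blockWt N q m * gNormSq N (kfine N q m κ) / (N : ℝ) ^ (D + 2) ≤ (D : ℝ) * π ^ 2 / 4 * ∏ i, wMaj N (m i) := by
  have hN0 : (0 : ℝ) < N := by exact_mod_cast hN
  have hW : 0 ≤ ∏ i, wMaj N (m i) := Finset.prod_nonneg fun i _ => wMaj_nonneg _ _
  have hmq := momSq_le_of_abs_le hq
  have h1 : blockWt N q m / (N : ℝ) ^ D ≤ (D * π ^ 2) / 4 * ∏ i, wMaj N (m i) :=
    (blockWt_div_le_of_ne_zero hN hq hm).trans (mul_le_mul_of_nonneg_right (by linarith) hW)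
  have h2 : gNormSq N (kfine N q m κ) / (N : ℝ) ^ 2 ≤ 1 := by rw [div_le_one (by positivity)]; exact gNormSq_le_sq N _
  have e : blockWt N q m * gNormSq N (kfine N q m κ) / (N : ℝ) ^ (D + 2)
      = (blockWt N q m / (N : ℝ) ^ D) * (gNormSq N (kfine N q m κ) / (N : ℝ) ^ 2) := by rw [pow_add]; field_simp
  rw [e]
  calc (blockWt N q m / (N : ℝ) ^ D) * (gNormSq N (kfine N q m κ) / (N : ℝ) ^ 2)
      ≤ ((D * π ^ 2) / 4 * ∏ i, wMaj N (m i)) * 1 :=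
        mul_le_mul h1 h2 (div_nonneg (gNormSq_nonneg _ _) (by positivity)) (by positivity)
    _ = (D : ℝ) * π ^ 2 / 4 * ∏ i, wMaj N (m i) := by ring

/-- [folklore] ZERO ALIAS, `wM̃`: `(blockWt₀/N^D)·(N²L₀)/(N²L₀) ≤ 1`. -/
theorem wM_sq_zero_le (hN : 1 ≤ N) (hq : ∀ i, |q i| ≤ π) (hq0 : q ≠ 0) :
    blockWt N q 0 / (N : ℝ) ^ D * (((N : ℝ) ^ 2 * lapR (kfine N q 0)) / ((N : ℝ) ^ 2 * lapR (kfine N q 0))) ≤ 1 := by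
  have hN0 : (0 : ℝ) < N := by exact_mod_cast hN
  have hR := R0_pos hN hq hq0
  rw [div_self hR.ne', mul_one, div_le_one (by positivity)]
  exact blockWt_le_pow hN q 0

/-- [folklore] NONZERO ALIAS, `wM̃`: `(blockWt/N^D)·(N²L₀)/(N²L_m) ≤ (Dπ²)²/16 · Π wMaj`. -/
theorem wM_sq_ne_zero_le [NeZero N] (hN : 1 ≤ N) (hq : ∀ i, |q i| ≤ π) (hq0 : q ≠ 0) {m : Fin D → ZMod N} (hm : m ≠ 0) :
    blockWt N q m / (N : ℝ) ^ D * (((N : ℝ) ^ 2 * lapR (kfine N q 0)) / ((N : ℝ) ^ 2 * lapR (kfine N q m)))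
      ≤ ((D : ℝ) * π ^ 2) ^ 2 / 16 * ∏ i, wMaj N (m i) := by
  have hN0 : (0 : ℝ) < N := by exact_mod_cast hN
  have hRm := four_le_sq_mul_lapR hq hm
  have hRmpos := Rm_pos hq hm
  have hR0 := R0_le hN hq
  have hR0nn : 0 ≤ (N : ℝ) ^ 2 * lapR (kfine N q 0) := (R0_pos hN hq hq0).le
  have hW : 0 ≤ ∏ i, wMaj N (m i) := Finset.prod_nonneg fun i _ => wMaj_nonneg _ _
  have hmq := momSq_le_of_abs_le hq
  have h1 : blockWt N q m / (N : ℝ) ^ D ≤ (D * π ^ 2) / 4 * ∏ i, wMaj N (m i) :=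
    (blockWt_div_le_of_ne_zero hN hq hm).trans (mul_le_mul_of_nonneg_right (by linarith) hW)
  have h3 : ((N : ℝ) ^ 2 * lapR (kfine N q 0)) / ((N : ℝ) ^ 2 * lapR (kfine N q m)) ≤ (D * π ^ 2) / 4 := by
    rw [div_le_div_iff₀ hRmpos (by norm_num)]
    have h0 : (0 : ℝ) ≤ D * π ^ 2 := by positivity
    calc ((N : ℝ) ^ 2 * lapR (kfine N q 0)) * 4 ≤ (D * π ^ 2) * 4 := by nlinarith
      _ ≤ (D * π ^ 2) * ((N : ℝ) ^ 2 * lapR (kfine N q m)) := mul_le_mul_of_nonneg_left hRm h0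
  calc blockWt N q m / (N : ℝ) ^ D * (((N : ℝ) ^ 2 * lapR (kfine N q 0)) / ((N : ℝ) ^ 2 * lapR (kfine N q m)))
      ≤ ((D * π ^ 2) / 4 * ∏ i, wMaj N (m i)) * ((D * π ^ 2) / 4) :=
        mul_le_mul h1 h3 (div_nonneg hR0nn hRmpos.le) (by positivity)
    _ = ((D : ℝ) * π ^ 2) ^ 2 / 16 * ∏ i, wMaj N (m i) := by ring

/-! ## §3 The four alias sums -/

/-- [folklore] Splitting a sum over `(ℤ/N)^D` into the zero alias and the rest. -/
theorem sum_eq_zero_add [NeZero N] {f : (Fin D → ZMod N) → ℝ} :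
    ∑ m, f m = f 0 + ∑ m ∈ (Finset.univ : Finset (Fin D → ZMod N)).erase 0, f m := by
  classical
  rw [← Finset.add_sum_erase _ _ (Finset.mem_univ (0 : Fin D → ZMod N))]

/-- [folklore] Generic assembly: a zero-alias bound `a` and a nonzero-alias bound `c·Π wMaj` give `Σ_m ≤ a + c·(5^D − 1)`. -/
theorem sum_le_of_split [NeZero N] {f : (Fin D → ZMod N) → ℝ} {a c : ℝ} (hc : 0 ≤ c) (h0 : f 0 ≤ a)
    (h1 : ∀ m : Fin D → ZMod N, m ≠ 0 → f m ≤ c * ∏ i, wMaj N (m i)) :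
    ∑ m, f m ≤ a + c * ((5 : ℝ) ^ D - 1) := by
  classical
  rw [sum_eq_zero_add]
  refine add_le_add h0 ?_
  calc ∑ m ∈ (Finset.univ : Finset (Fin D → ZMod N)).erase 0, f m
      ≤ ∑ m ∈ (Finset.univ : Finset (Fin D → ZMod N)).erase 0, c * ∏ i, wMaj N (m i) :=
        Finset.sum_le_sum fun m hm => h1 m (Finset.ne_of_mem_erase hm)
    _ = c * ∑ m ∈ (Finset.univ : Finset (Fin D → ZMod N)).erase 0, ∏ i, wMaj N (m i) := by rw [Finset.mul_sum]
    _ ≤ c * ((5 : ℝ) ^ D - 1) := mul_le_mul_of_nonneg_left (sum_prod_wMaj_le N) hc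

/-- **THE `EL–φ` BORDER (scaled `wẼ`), FROBENIUS²**: `Σ_m Σ_κ blockWt·gNormSq_κ·(N²L₀)²/(N^{D+2}(N²L_m)²) ≤ D·(1 + (Dπ²)³(5^D − 1)/64)` for every `N ≥ 1`,
`q ∈ [−π, π]^D ∖ {0}`. [folklore] -/
theorem sum_wE_sq_le [NeZero N] (hN : 1 ≤ N) (hq : ∀ i, |q i| ≤ π) (hq0 : q ≠ 0) :
    ∑ m : Fin D → ZMod N, ∑ κ : Fin D, blockWt N q m * gNormSq N (kfine N q m κ) * ((N : ℝ) ^ 2 * lapR (kfine N q 0)) ^ 2 /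
        ((N : ℝ) ^ (D + 2) * ((N : ℝ) ^ 2 * lapR (kfine N q m)) ^ 2)
      ≤ D * (1 + ((D : ℝ) * π ^ 2) ^ 3 * ((5 : ℝ) ^ D - 1) / 64) := by
  have h := sum_le_of_split (N := N) (a := (D : ℝ)) (c := D * (((D : ℝ) * π ^ 2) ^ 3 / 64)) (by positivity)
    (f := fun m => ∑ κ : Fin D, blockWt N q m * gNormSq N (kfine N q m κ) * ((N : ℝ) ^ 2 * lapR (kfine N q 0)) ^ 2 /
        ((N : ℝ) ^ (D + 2) * ((N : ℝ) ^ 2 * lapR (kfine N q m)) ^ 2)) ?_ ?_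
  · refine h.trans (le_of_eq ?_); ring
  · calc ∑ κ : Fin D, blockWt N q 0 * gNormSq N (kfine N q 0 κ) * ((N : ℝ) ^ 2 * lapR (kfine N q 0)) ^ 2 /
            ((N : ℝ) ^ (D + 2) * ((N : ℝ) ^ 2 * lapR (kfine N q 0)) ^ 2)
        ≤ ∑ _κ : Fin D, (1 : ℝ) := Finset.sum_le_sum fun κ _ => wE_sq_zero_le hN hq hq0 κ
      _ = D := by simp
  · intro m hm
    calc ∑ κ : Fin D, blockWt N q m * gNormSq N (kfine N q m κ) * ((N : ℝ) ^ 2 * lapR (kfine N q 0)) ^ 2 /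
            ((N : ℝ) ^ (D + 2) * ((N : ℝ) ^ 2 * lapR (kfine N q m)) ^ 2)
        ≤ ∑ _κ : Fin D, ((D : ℝ) * π ^ 2) ^ 3 / 64 * ∏ i, wMaj N (m i) :=
          Finset.sum_le_sum fun κ _ => wE_sq_ne_zero_le hN hq hq0 hm κ
      _ = D * (((D : ℝ) * π ^ 2) ^ 3 / 64) * ∏ i, wMaj N (m i) := by simp; ring

/-- **THE `G–c` BORDER (scaled `wG̃`), FROBENIUS²**: `Σ_m (blockWt/N^D)·(N²L₀)³/(N²L_m)³ ≤ 1 + (Dπ²)⁴(5^D − 1)/256`. [folklore] -/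
theorem sum_wG_sq_le [NeZero N] (hN : 1 ≤ N) (hq : ∀ i, |q i| ≤ π) (hq0 : q ≠ 0) :
    ∑ m : Fin D → ZMod N, blockWt N q m / (N : ℝ) ^ D * (((N : ℝ) ^ 2 * lapR (kfine N q 0)) ^ 3 / ((N : ℝ) ^ 2 * lapR (kfine N q m)) ^ 3)
      ≤ 1 + ((D : ℝ) * π ^ 2) ^ 4 * ((5 : ℝ) ^ D - 1) / 256 := by
  have h := sum_le_of_split (N := N) (a := (1 : ℝ)) (c := ((D : ℝ) * π ^ 2) ^ 4 / 256) (by positivity)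
    (f := fun m => blockWt N q m / (N : ℝ) ^ D * (((N : ℝ) ^ 2 * lapR (kfine N q 0)) ^ 3 / ((N : ℝ) ^ 2 * lapR (kfine N q m)) ^ 3))
    (wG_sq_zero_le hN hq hq0) (fun m hm => wG_sq_ne_zero_le hN hq hq0 hm)
  refine h.trans (le_of_eq ?_); ring

/-- **THE `Q–A` BORDER (scaled `wQ̃`), FROBENIUS²**: `Σ_m Σ_κ blockWt·gNormSq_κ/N^{D+2} ≤ D·(1 + Dπ²(5^D − 1)/4)` (no `q ≠ 0` needed). [folklore] -/
theorem sum_wQ_sq_le [NeZero N] (hN : 1 ≤ N) (hq : ∀ i, |q i| ≤ π) :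
    ∑ m : Fin D → ZMod N, ∑ κ : Fin D, blockWt N q m * gNormSq N (kfine N q m κ) / (N : ℝ) ^ (D + 2)
      ≤ D * (1 + (D : ℝ) * π ^ 2 * ((5 : ℝ) ^ D - 1) / 4) := by
  have h := sum_le_of_split (N := N) (a := (D : ℝ)) (c := D * ((D : ℝ) * π ^ 2 / 4)) (by positivity)
    (f := fun m => ∑ κ : Fin D, blockWt N q m * gNormSq N (kfine N q m κ) / (N : ℝ) ^ (D + 2)) ?_ ?_
  · refine h.trans (le_of_eq ?_); ring
  · calc ∑ κ : Fin D, blockWt N q 0 * gNormSq N (kfine N q 0 κ) / (N : ℝ) ^ (D + 2)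
        ≤ ∑ _κ : Fin D, (1 : ℝ) := Finset.sum_le_sum fun κ _ => wQ_sq_zero_le hN κ
      _ = D := by simp
  · intro m hm
    calc ∑ κ : Fin D, blockWt N q m * gNormSq N (kfine N q m κ) / (N : ℝ) ^ (D + 2)
        ≤ ∑ _κ : Fin D, (D : ℝ) * π ^ 2 / 4 * ∏ i, wMaj N (m i) := Finset.sum_le_sum fun κ _ => wQ_sq_ne_zero_le hN hq hm κ
      _ = D * ((D : ℝ) * π ^ 2 / 4) * ∏ i, wMaj N (m i) := by simp; ring

/-- **THE `M–μ` BORDER (scaled `wM̃`), FROBENIUS²**: `Σ_m (blockWt/N^D)·(N²L₀)/(N²L_m) ≤ 1 + (Dπ²)²(5^D − 1)/16`. [folklore] -/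
theorem sum_wM_sq_le [NeZero N] (hN : 1 ≤ N) (hq : ∀ i, |q i| ≤ π) (hq0 : q ≠ 0) :
    ∑ m : Fin D → ZMod N, blockWt N q m / (N : ℝ) ^ D * (((N : ℝ) ^ 2 * lapR (kfine N q 0)) / ((N : ℝ) ^ 2 * lapR (kfine N q m)))
      ≤ 1 + ((D : ℝ) * π ^ 2) ^ 2 * ((5 : ℝ) ^ D - 1) / 16 := by
  have h := sum_le_of_split (N := N) (a := (1 : ℝ)) (c := ((D : ℝ) * π ^ 2) ^ 2 / 16) (by positivity)
    (f := fun m => blockWt N q m / (N : ℝ) ^ D * (((N : ℝ) ^ 2 * lapR (kfine N q 0)) / ((N : ℝ) ^ 2 * lapR (kfine N q m))))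
    (wM_sq_zero_le hN hq hq0) (fun m hm => wM_sq_ne_zero_le hN hq hq0 hm)
  refine h.trans (le_of_eq ?_); ring

end Summit.QuantumFields.BalabanUV.Beta.GAN24.ArrowAnchorRealBorders

end
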